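import Literature.Analysis.FluidPDE.DivCurlL2
import Literature.Analysis.FluidPDE.MollifiedField
import Literature.Analysis.FluidPDE.NSLerayRegularisedLimitHolds
import Literature.Analysis.FluidPDE.NSGaldiExtendedTest
import Literature.Analysis.FunctionSpaces.MollificationLp
import HarnessLib

/-!
# Weak gradients from weak vorticities: `L⁴` fields with `L²` curl in dimension `3`

Analysis/FluidPDE support file in the discharge programme of the named fact
`Literature.Analysis.FluidPDE.galdi_energy_equality` (Galdi 2019, Proc. AMS 147, Thm. 1.1), layer
`Literature.Analysis.FluidPDE.galdi_lerayHopf_class`, step "vorticity in `L²` ⇒ gradient in `L²`".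
The duality bounds of `NSGaldiDualityBounds` control, slice by slice, the *weak vorticity*
`ω_{ij} = ∂ᵢv_j - ∂ⱼv_i` of the `L⁴` slices `v(t)` in `L²`; this file converts that information
into a square-integrable weak gradient, for a single field:

* `Literature.Analysis.FluidPDE.exists_hasWeakGradient_of_weakVorticity`: if `finrank ℝ E = 3`,
  `w ∈ L⁴(E; E)` is weakly divergence free and for all frame indices `i, j` some
  `ω_{ij} ∈ L²(E)` satisfies `∫ ((∂ᵢφ)⟪w, eⱼ⟫ − (∂ⱼφ)⟪w, eᵢ⟫) = ∫ ω_{ij} φ` for all real test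
  functions `φ`, then `w` has a weak gradient `G` (`Fluid.HasWeakGradient`) with
  `∫ |G|²_F ≤ ½ Σᵢⱼ ‖ω_{ij}‖₂²`.

Proof: mollify, `Wₙ = ρₙ ⋆ w`; the accepted `MollifiedField` gives `div Wₙ = 0`, `Wₙ ∈ L⁴` and
the spin entries `⟪DWₙ eᵢ, eⱼ⟫ - ⟪DWₙ eⱼ, eᵢ⟫ = -(ρₙ ⋆ ω_{ij})`; the accepted `div`–`curl`
estimate in dimension `3` (`DivCurlL2.lintegral_frobeniusNormSq_fderiv_le_of_memLp_two_add_four`,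
no a priori `L²` assumption on `Wₙ` or `DWₙ`) bounds `∫|DWₙ|²_F` by
`½ Σᵢⱼ ‖ρₙ ⋆ ω_{ij}‖₂² ≤ ½ Σᵢⱼ ‖ω_{ij}‖₂²` (Jensen); `Wₙ → w` in `L⁴`
(`Literature.Analysis.FunctionSpaces.tendsto_eLpNorm_normed_convolution_sub_self`), so the
pairings `∫⟪c, (∂ᵥθ) Wₙ⟫` converge, and the generic weak-limit lemma
`exists_hasWeakGradient_of_tendsto_pairing` (weak compactness of the gradient tuples in `L²`,
accepted `exists_subseq_weakLimit_of_sq_le` / `tupleToCLM` of `NSLerayRegularisedLimitHolds`,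
and passage to the limit in the integration-by-parts identities) produces the weak gradient with
the Fatou bound. Also proved: convergence of `L⁴`–`L^{4/3}` pairings under `L⁴` convergence
(`tendsto_integral_inner_of_tendsto_eLpNorm_four`). No new definitions.

## Mathlib / tree search

Mathlib: `HasCompactSupport.contDiff_convolution_left`, `eLpNorm_le_eLpNorm_mul_eLpNorm_of_nnnorm`,
`enorm_integral_le_lintegral_enorm`, `ext_inner_left`. Tree: `DivCurlL2`, `MollifiedField`,
`NSLerayRegularisedLimitHolds` (`gradTuple`, `tupleToCLM`, `testTuple`,
`exists_subseq_weakLimit_of_sq_le`), `Mollification`/`MollificationLp`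
(`exists_contDiffBump_seq`, `tendsto_eLpNorm_normed_convolution_sub_self`), `WholeSpaceIBP`
(`HasWeakGradient.of_contDiff_holds`), `NSGaldiExtendedTest` (`holderTriple_four_fourThirds`).

## References

* G. P. Galdi, *On the energy equality for distributional solutions to Navier–Stokes equations*,
  Proc. Amer. Math. Soc. 147 (2019), 785–792, Thm. 1.1 (the fact served). Bib key `Galdi2018`.
* H. Sohr, *The Navier–Stokes equations*, Birkhäuser 2001, Ch. II, §1.1–1.2 (`div`–`curl`
  identities on the whole space) and Ch. V, §1.4. Bib key `Sohr2001`.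
-/

noncomputable section

open MeasureTheory TopologicalSpace Set Function Filter Topology InnerProductSpace Metric
  ContinuousLinearMap
open scoped RealInnerProductSpace ENNReal NNReal ContDiff Convolution

namespace Literature.Analysis.FluidPDE

variable {E : Type*} [NormedAddCommGroup E] [InnerProductSpace ℝ E] [FiniteDimensional ℝ E]
  [MeasurableSpace E] [BorelSpace E]

/-! ### Pairings under `L⁴` convergence -/

section Pairing

variable {α : Type*} [MeasurableSpace α] {μ : Measure α}
variable {F : Type*} [NormedAddCommGroup F] [InnerProductSpace ℝ F]

/-- `⟪h, z⟫` is integrable for `h ∈ L⁴`, `z ∈ L^{4/3}`. [folklore] -/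
theorem integrable_inner_of_memLp_four_fourThirds {h z : α → F} (hh : MemLp h 4 μ)
    (hz : MemLp z (4 / 3) μ) : Integrable (fun x => ⟪h x, z x⟫) μ := by
  haveI := holderTriple_four_fourThirds
  refine (hh.norm.integrable_mul hz.norm).mono' (hh.1.inner hz.1) (Eventually.of_forall fun x => ?_)
  exact (norm_inner_le_norm _ _)

/-- **`L⁴` convergence gives convergence of the pairings with `L^{4/3}` fields.** [folklore] -/
theorem tendsto_integral_inner_of_tendsto_eLpNorm_four {f : ℕ → α → F} {g z : α → F}
    (hf : ∀ n, MemLp (f n) 4 μ) (hg : MemLp g 4 μ) (hz : MemLp z (4 / 3) μ)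
    (h : Tendsto (fun n => eLpNorm (f n - g) 4 μ) atTop (𝓝 0)) :
    Tendsto (fun n => ∫ x, ⟪f n x, z x⟫ ∂μ) atTop (𝓝 (∫ x, ⟪g x, z x⟫ ∂μ)) := by
  haveI := holderTriple_four_fourThirds
  have hbound : ∀ n, edist (∫ x, ⟪f n x, z x⟫ ∂μ) (∫ x, ⟪g x, z x⟫ ∂μ) ≤
      eLpNorm (f n - g) 4 μ * eLpNorm z (4 / 3) μ := fun n => by
    rw [edist_eq_enorm_sub, ← integral_sub (integrable_inner_of_memLp_four_fourThirds (hf n) hz)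
      (integrable_inner_of_memLp_four_fourThirds hg hz)]
    have heq : (fun x => ⟪f n x, z x⟫ - ⟪g x, z x⟫) = fun x => ⟪(f n - g) x, z x⟫ := by
      funext x; rw [Pi.sub_apply, inner_sub_left]
    rw [heq]
    refine (enorm_integral_le_lintegral_enorm _).trans ?_
    rw [← eLpNorm_one_eq_lintegral_enorm]
    have h1 := eLpNorm_le_eLpNorm_mul_eLpNorm_of_nnnorm ((hf n).sub hg).1 hz.1
      (fun (u v : F) => (⟪u, v⟫ : ℝ)) 1 (Eventually.of_forall fun x => by
        simpa using nnnorm_inner_le_nnnorm ((f n - g) x) (z x)) (p := 4) (q := 4 / 3) (r := 1)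
    simpa using h1
  have hlim : Tendsto (fun n => eLpNorm (f n - g) 4 μ * eLpNorm z (4 / 3) μ) atTop (𝓝 0) := by
    have := ENNReal.Tendsto.mul_const h (Or.inr hz.eLpNorm_ne_top)
    rwa [zero_mul] at this
  rw [tendsto_iff_edist_tendsto_0]
  exact tendsto_of_tendsto_of_tendsto_of_le_of_le tendsto_const_nhds hlim (fun _ => zero_le) hbound

end Pairing

/-! ### Weak gradients as weak limits of gradients of smooth approximations -/

section WeakLimit

/-- **Weak gradient of a limit with the Fatou bound.** Let `w` be locally integrable and `W n`
be `C¹` fields whose pairings `∫ ⟪c, (∂ᵥθ) W n⟫` converge to those of `w` for all real test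
functions `θ` and vectors `v, c`, with uniformly bounded dissipation `∫ |DW n|² ≤ L < ∞`. Then
`w` has a weak gradient `G` with `∫ |G|² ≤ L` (weak compactness of the gradient tuples in `L²`,
tree `exists_subseq_weakLimit_of_sq_le`, and passage to the limit in the integration-by-parts
identities). [folklore] -/
theorem exists_hasWeakGradient_of_tendsto_pairing {w : E → E} {W : ℕ → E → E}
    (hwl : LocallyIntegrable w volume) (hW : ∀ n, ContDiff ℝ 1 (W n))
    (hconv : ∀ θ : E → ℝ, FunctionSpaces.IsTestFunctionOn (⊤ : Opens E) θ → ∀ v c : E,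
      Tendsto (fun n => ∫ x, ⟪c, (fderiv ℝ θ x v) • W n x⟫) atTop
        (𝓝 (∫ x, ⟪c, (fderiv ℝ θ x v) • w x⟫)))
    {L : ℝ≥0∞} (hL : L ≠ ⊤)
    (hbd : ∀ n, ∫⁻ x, ENNReal.ofReal (frobeniusNormSq (fderiv ℝ (W n) x)) ≤ L) :
    ∃ G : E → E →L[ℝ] E, HasWeakGradient w G ∧
      ∫⁻ x, ENNReal.ofReal (frobeniusNormSq (G x)) ≤ L := by
  -- the gradient tuples and their bounds
  set g₀ : ℕ → E → GradTuple E := fun n => gradTuple (W n) with hg₀_def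
  have hfin : ∀ n, ∫⁻ x, ENNReal.ofReal (frobeniusNormSq (fderiv ℝ (W n) x)) < ⊤ := fun n =>
    (hbd n).trans_lt hL.lt_top
  have hg₀ : ∀ n, MemLp (g₀ n) 2 (volume : Measure E) := fun n => memLp_gradTuple (hW n) (hfin n)
  have hb : ∀ n, ‖(hg₀ n).toLp (g₀ n)‖ ^ 2 ≤ L.toReal + 1 / ((n : ℝ) + 1) := fun n => by
    rw [Lp.norm_toLp, ← ENNReal.toReal_pow, eLpNorm_gradTuple_sq]
    exact (ENNReal.toReal_mono hL (hbd n)).trans (le_add_of_nonneg_right (by positivity))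
  obtain ⟨κ, g, hg, hκ, hgL, hweak⟩ := exists_subseq_weakLimit_of_sq_le hg₀ ENNReal.toReal_nonneg hb
  refine ⟨tupleToCLM g, ?_, ?_⟩
  swap
  · rw [lintegral_frobeniusNormSq_tupleToCLM]
    have h1 : eLpNorm g 2 (volume : Measure E) = ENNReal.ofReal ‖hg.toLp g‖ := by
      rw [Lp.norm_toLp, ENNReal.ofReal_toReal hg.eLpNorm_ne_top]
    rw [h1, ← ENNReal.ofReal_pow (norm_nonneg _), ← ENNReal.ofReal_toReal hL]
    exact ENNReal.ofReal_le_ofReal hgL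
  -- the integration-by-parts identity in the limit
  have hG2 : MemLp (tupleToCLM g) 2 (volume : Measure E) := memLp_tupleToCLM hg
  refine ⟨hwl.locallyIntegrableOn _, (hG2.locallyIntegrable one_le_two).locallyIntegrableOn _,
    fun θ v hθ => ?_⟩
  simp only [TopologicalSpace.Opens.coe_top, Measure.restrict_univ]
  have hθ2 : MemLp θ 2 (volume : Measure E) := memLp_of_isTestFunctionOn_real hθ 2
  have hdθc : Continuous fun x => fderiv ℝ θ x v :=
    (hθ.contDiff.continuous_fderiv (by simp)).clm_apply continuous_const
  have hdθs : HasCompactSupport fun x => fderiv ℝ θ x v := hθ.hasCompactSupport.fderiv_apply (𝕜 := ℝ) v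
  have iL : Integrable (fun x => (fderiv ℝ θ x v) • w x) volume :=
    hwl.integrable_smul_left_of_hasCompactSupport hdθc hdθs
  have iR : Integrable (fun x => θ x • tupleToCLM g x v) volume :=
    integrable_smul_of_memLp_two hθ2 (memLp_clm_apply hG2 v)
  refine ext_inner_left ℝ fun c => ?_
  rw [inner_neg_right, ← integral_inner iL c, ← integral_inner iR c]
  -- the identities for the approximations
  have hidk : ∀ k, ∫ x, ⟪c, (fderiv ℝ θ x v) • W (κ k) x⟫ =
      -∫ x, ⟪g₀ (κ k) x, testTuple θ v c x⟫ := by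
    intro k
    have hk := (HasWeakGradient.of_contDiff_holds (hW (κ k))).integral_fderiv_smul_eq θ v hθ
    simp only [TopologicalSpace.Opens.coe_top, Measure.restrict_univ] at hk
    have iLk : Integrable (fun x => (fderiv ℝ θ x v) • W (κ k) x) volume :=
      ((hW (κ k)).continuous.locallyIntegrable).integrable_smul_left_of_hasCompactSupport hdθc hdθs
    have hcont : Continuous fun x => fderiv ℝ (W (κ k)) x v :=
      ((hW (κ k)).continuous_fderiv one_ne_zero).clm_apply continuous_const
    have iRk : Integrable (fun x => θ x • fderiv ℝ (W (κ k)) x v) volume :=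
      (hθ.contDiff.continuous.smul hcont).integrable_of_hasCompactSupport hθ.hasCompactSupport.smul_right
    rw [integral_inner iLk c, hk, inner_neg_right, ← integral_inner iRk c]
    congr 1
    refine integral_congr_ae (Eventually.of_forall fun x => ?_)
    show ⟪c, θ x • fderiv ℝ (W (κ k)) x v⟫ = ⟪gradTuple (W (κ k)) x, testTuple θ v c x⟫
    rw [← tupleToCLM_gradTuple_apply, real_inner_smul_right, real_inner_comm, ← real_inner_smul_right,
      inner_tupleToCLM_apply_smul]
  -- pass to the limit on both sides
  have hlhs : Tendsto (fun k => ∫ x, ⟪c, (fderiv ℝ θ x v) • W (κ k) x⟫) atTop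
      (𝓝 (∫ x, ⟪c, (fderiv ℝ θ x v) • w x⟫)) := (hconv θ hθ v c).comp hκ.tendsto_atTop
  have hrhs : Tendsto (fun k => -∫ x, ⟪g₀ (κ k) x, testTuple θ v c x⟫) atTop
      (𝓝 (-∫ x, ⟪g x, testTuple θ v c x⟫)) := (hweak _ (memLp_testTuple hθ v c)).neg
  have hA := tendsto_nhds_unique hlhs (hrhs.congr fun k => (hidk k).symm)
  rw [hA]
  congr 1
  refine integral_congr_ae (Eventually.of_forall fun x => ?_)
  show ⟪g x, testTuple θ v c x⟫ = ⟪c, θ x • tupleToCLM g x v⟫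
  rw [real_inner_smul_right, ← real_inner_comm c (tupleToCLM g x v), ← real_inner_smul_right,
    inner_tupleToCLM_apply_smul]

end WeakLimit

/-! ### From an `L²` weak vorticity to an `L²` weak gradient -/

section DivCurl

/-- **An `L⁴` divergence-free field with `L²` weak vorticity has an `L²` weak gradient**
(dimension `3`). Let `finrank ℝ E = 3`, `w ∈ L⁴(E; E)` weakly divergence free, and suppose that
for every pair `(i, j)` of frame indices there is `ω_{ij} ∈ L²(E)` with
`∫ ((∂ᵢφ)⟪w, eⱼ⟫ − (∂ⱼφ)⟪w, eᵢ⟫) = ∫ ω_{ij} φ` for every real test function `φ` (`ω_{ij}` is the weak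
`(eᵢ, eⱼ)`-vorticity of `w`). Then `w` has a weak gradient `G` with
`∫ |G|²_F ≤ ½ Σᵢⱼ ‖ω_{ij}‖₂²`.
Proof: the mollifications `Wₙ = ρₙ ⋆ w` are smooth, divergence free, in `L⁴`, and their spin
entries are `-(ρₙ ⋆ ω_{ij})` (accepted `MollifiedField`); by the `div`–`curl` estimate
(accepted `DivCurlL2`, dimension `3`) `∫|DWₙ|²_F ≤ ½ Σᵢⱼ ‖ρₙ ⋆ ω_{ij}‖₂² ≤ ½ Σᵢⱼ ‖ω_{ij}‖₂²`
(Jensen), and `Wₙ → w` in `L⁴`, so the weak limit lemma applies. This is the step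
"vorticity in `L²` ⇒ gradient in `L²`" of the tree's proof of Galdi 2019, Thm. 1.1. [folklore] -/
theorem exists_hasWeakGradient_of_weakVorticity (h3 : Module.finrank ℝ E = 3) {w : E → E}
    (hw4 : MemLp w 4 volume) (hdiv : IsWeaklyDivFree w)
    {om : Fin (Module.finrank ℝ E) → Fin (Module.finrank ℝ E) → E → ℝ}
    (hom2 : ∀ i j, MemLp (om i j) 2 volume)
    (hom : ∀ i j, ∀ φ : E → ℝ, FunctionSpaces.IsTestFunctionOn (⊤ : Opens E) φ →
      ∫ y, (fderiv ℝ φ y (stdOrthonormalBasis ℝ E i) * ⟪w y, stdOrthonormalBasis ℝ E j⟫ -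
        fderiv ℝ φ y (stdOrthonormalBasis ℝ E j) * ⟪w y, stdOrthonormalBasis ℝ E i⟫) =
        ∫ y, om i j y * φ y) :
    ∃ G : E → E →L[ℝ] E, HasWeakGradient w G ∧
      ∫⁻ x, ENNReal.ofReal (frobeniusNormSq (G x)) ≤
        ENNReal.ofReal ((1 / 2) * ∑ i, ∑ j, ∫ y, om i j y ^ 2) := by
  set b := stdOrthonormalBasis ℝ E
  obtain ⟨φ, hφ0, -⟩ := FunctionSpaces.exists_contDiffBump_seq (E := E)
  set ρ : ℕ → E → ℝ := fun n => (φ n).normed volume with hρ_def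
  have hρs : ∀ n, ContDiff ℝ ∞ (ρ n) := fun n => (φ n).contDiff_normed
  have hρc : ∀ n, HasCompactSupport (ρ n) := fun n => (φ n).hasCompactSupport_normed
  have hρ0 : ∀ n y, 0 ≤ ρ n y := fun n y => (φ n).nonneg_normed y
  have hρ1 : ∀ n, ∫ y, ρ n y = 1 := fun n => (φ n).integral_normed
  have hwl : LocallyIntegrable w volume := hw4.locallyIntegrable (by norm_num)
  set W : ℕ → E → E := fun n => ρ n ⋆[lsmul ℝ ℝ, volume] w with hW_def
  -- smoothness, divergence, `L⁴`
  have hWs : ∀ n, ContDiff ℝ ∞ (W n) := fun n =>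
    (hρc n).contDiff_convolution_left _ (hρs n) hwl
  have hWdiv : ∀ n, VectorCalculus.IsDivFree (W n) := fun n x =>
    divergence_convolution_eq_zero (hρs n) (hρc n) hwl hdiv x
  have hW4 : ∀ n, MemLp (W n) 4 volume := fun n =>
    (memLp_four_convolution (hρs n).continuous (hρc n) (hρ0 n) (hρ1 n) hw4).1
  -- the spin entries are the mollified vorticities
  have hspin : ∀ n i j x, ⟪fderiv ℝ (W n) x (b i), b j⟫ - ⟪fderiv ℝ (W n) x (b j), b i⟫ =
      -(ρ n ⋆[lsmul ℝ ℝ, volume] om i j) x := fun n i j x =>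
    inner_fderiv_convolution_sub_eq (hρs n) (hρc n) hwl (hom i j) x
  -- the `div`–`curl` bound
  set L : ℝ := (1 / 2) * ∑ i, ∑ j, ∫ y, om i j y ^ 2 with hL
  have hom2' : ∀ i j, Integrable (fun y => om i j y ^ 2) volume := fun i j => by
    have h := (memLp_two_iff_integrable_sq_norm (hom2 i j).1).1 (hom2 i j)
    exact h.congr (Eventually.of_forall fun y => by simp)
  have hmol2 : ∀ n i j, Integrable (fun x => ((ρ n ⋆[lsmul ℝ ℝ, volume] om i j) x) ^ 2) volume ∧
      ∫ x, ((ρ n ⋆[lsmul ℝ ℝ, volume] om i j) x) ^ 2 ≤ ∫ y, om i j y ^ 2 := fun n i j => by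
    obtain ⟨hm, hle⟩ := memLp_two_convolution (hρs n).continuous (hρc n) (hρ0 n) (hρ1 n) (hom2 i j)
    have hi := (memLp_two_iff_integrable_sq_norm hm.1).1 hm
    refine ⟨hi.congr (Eventually.of_forall fun x => by simp), ?_⟩
    have e1 : ∫ x, ((ρ n ⋆[lsmul ℝ ℝ, volume] om i j) x) ^ 2 = ∫ x, ‖(ρ n ⋆[lsmul ℝ ℝ, volume] om i j) x‖ ^ 2 :=
      integral_congr_ae (Eventually.of_forall fun x => by simp)
    have e2 : ∫ y, om i j y ^ 2 = ∫ y, ‖om i j y‖ ^ 2 :=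
      integral_congr_ae (Eventually.of_forall fun y => by simp)
    rw [e1, e2]; exact hle
  have hbd : ∀ n, ∫⁻ x, ENNReal.ofReal (frobeniusNormSq (fderiv ℝ (W n) x)) ≤ ENNReal.ofReal L := by
    intro n
    have h1 := lintegral_frobeniusNormSq_fderiv_le_of_memLp_two_add_four h3 b
      (contDiff_infty.1 (hWs n) 2) (hWdiv n) (by simp : W n = 0 + W n) (MemLp.zero) (hW4 n)
    refine h1.trans ?_
    -- the antisymmetric density is `½ Σᵢⱼ (ρₙ ⋆ ω_{ij})²`, integrable
    set D : E → ℝ := fun x => (1 / 2) * ∑ i, ∑ j, ((ρ n ⋆[lsmul ℝ ℝ, volume] om i j) x) ^ 2 with hD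
    have hDeq : ∀ x, (1 / 2) * ∑ i, ∑ j, (⟪fderiv ℝ (W n) x (b i), b j⟫ -
        ⟪fderiv ℝ (W n) x (b j), b i⟫) ^ 2 = D x := fun x => by
      simp only [hD, hspin, neg_sq]
    have hDi : Integrable D volume :=
      (integrable_finsetSum _ fun i _ => integrable_finsetSum _ fun j _ => (hmol2 n i j).1).const_mul _
    have hD0 : ∀ x, 0 ≤ D x := fun x => by
      simp only [hD]
      exact mul_nonneg (by norm_num) (Finset.sum_nonneg fun i _ => Finset.sum_nonneg fun j _ => sq_nonneg _)
    simp_rw [hDeq]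
    rw [← ofReal_integral_eq_lintegral_ofReal hDi (Eventually.of_forall hD0)]
    refine ENNReal.ofReal_le_ofReal ?_
    simp only [hD, hL]
    rw [integral_const_mul]
    refine mul_le_mul_of_nonneg_left ?_ (by norm_num)
    rw [integral_finsetSum _ fun i _ => integrable_finsetSum _ fun j _ => (hmol2 n i j).1]
    refine Finset.sum_le_sum fun i _ => ?_
    rw [integral_finsetSum _ fun j _ => (hmol2 n i j).1]
    exact Finset.sum_le_sum fun j _ => (hmol2 n i j).2
  -- `L⁴` convergence and the pairings
  have hconv4 : Tendsto (fun n => eLpNorm (W n - w) 4 volume) atTop (𝓝 0) :=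
    FunctionSpaces.tendsto_eLpNorm_normed_convolution_sub_self (μ := (volume : Measure E)) hφ0
      (by norm_num) (by norm_num) hw4
  have hconv : ∀ θ : E → ℝ, FunctionSpaces.IsTestFunctionOn (⊤ : Opens E) θ → ∀ v c : E,
      Tendsto (fun n => ∫ x, ⟪c, (fderiv ℝ θ x v) • W n x⟫) atTop
        (𝓝 (∫ x, ⟪c, (fderiv ℝ θ x v) • w x⟫)) := by
    intro θ hθ v c
    have hz : MemLp (fun x => (fderiv ℝ θ x v) • c) (4 / 3) (volume : Measure E) :=
      (((hθ.contDiff.continuous_fderiv (by simp)).clm_apply continuous_const).smul continuous_const)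
        |>.memLp_of_hasCompactSupport ((hθ.hasCompactSupport.fderiv_apply (𝕜 := ℝ) v).smul_right)
    have h := tendsto_integral_inner_of_tendsto_eLpNorm_four hW4 hw4 hz hconv4
    have hsw : ∀ (y : E → E) (x : E), ⟪c, (fderiv ℝ θ x v) • y x⟫ = ⟪y x, (fderiv ℝ θ x v) • c⟫ :=
      fun y x => by rw [real_inner_smul_right, real_inner_comm, ← real_inner_smul_right]
    simp_rw [hsw]
    exact h
  exact exists_hasWeakGradient_of_tendsto_pairing hwl (fun n => contDiff_infty.1 (hWs n) 1)
    hconv ENNReal.ofReal_ne_top hbd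

end DivCurl


end Literature.Analysis.FluidPDE
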